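import Summits.AtomisticToContinuum.HydrodynamicLimit.Theses.InformationPercolationEngine
import Summits.AtomisticToContinuum.HydrodynamicLimit.Theses.LimitCollisionMeasure
import Summits.AtomisticToContinuum.HydrodynamicLimit.Theorems.InformationPercolationEngineChaosClosesEulerWindowedInvariance
import Literature.Analysis.FluidPDE.EmpiricalCollisionMeasure
import HarnessLib

/-!
# Uniform integrability of the quadratic collision mark from quartic tightness (crux
`ChaosClosesEuler`, stmt-AtomisticToContinuum-15141, line `Sketch`, stub `stub_collisionMomentUI`)

WHAT. The registered stub `stub_collisionMomentUI` of the line `Sketch` on the crux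
`InformationPercolationEngine.ChaosClosesEuler`: GIVEN the moment tightness of the normalised
empirical collision measure (`LimitCollisionMeasure.CollisionTightness`, stmt-13354: for local Gibbs
data, `P((ε/(N+1)) ∫ (1 + |v⁻|⁴ + |v*⁻|⁴)(1 + 1/(π|v⁻ − v*⁻|)) dκ_N > Kb) ≤ δ` eventually in `N`), the
part of the normalised collision functional `K_N[1 + |vᵢ|² + |vⱼ|²]` of one hard-sphere trajectory
carried by the FAST contact pairs `|vᵢ|² + |vⱼ|² > L` is `≤ η` with probability `≥ 1 − δ`
eventually in `N`, for `L = 3 max(Kb, 0)/η`.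

PROOF (Chebyshev inside the collision sum). Along a good orbit the integral against the empirical
collision measure over `[0, τ]` IS the ordered-contact-pair collision sum
(`HardSphereFlow.integral_empiricalCollisionMeasure_eq_finsum_ite`), whose marks carry the
PRE-collisional pair `(vᵢ⁻, vⱼ⁻) = reflectVel (xᵢ − xⱼ) (vᵢ, vⱼ)` of the right-continuous orbit;
the elastic reflection conserves `|vᵢ|² + |vⱼ|²` (`norm_sq_reflectVel_fst_add_norm_sq_reflectVel_snd`).
Termwise, with `S = |vᵢ|² + |vⱼ|² = |vᵢ⁻|² + |vⱼ⁻|²`, on `{L < S}`: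
`1 + S ≤ (1 + S)²/(1 + L) ≤ 3(1 + S²/2)/(1 + L) ≤ 3(1 + |vᵢ⁻|⁴ + |vⱼ⁻|⁴)(1 + 1/(π|vᵢ⁻ − vⱼ⁻|))/(1 + L)`,
so pathwise `K_N[(1 + S)1_{S > L}] ≤ 3/(1 + L) · (ε/(N+1)) ∫ (1 + |v⁻|⁴ + |v*⁻|⁴)(1 + 1/(π|v⁻ − v*⁻|)) dκ_N`
(`tail_functional_le`). Hence on the good set `η < K_N[tail]` forces the tightness functional above
`η(1 + L)/3 = η/3 + max(Kb, 0) > Kb`; the bad set is null for the local Gibbs law (`≪` Liouville),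
and the tightness bound closes. The statement of `stub_collisionMomentUI` is the skeleton's (v4)
verbatim; `measure_tail_event_le` is its `let`-free form at one particle number.

REFERENCES. M. Pulvirenti, S. Simonella, *On the evolution of the empirical measure for the
hard-sphere dynamics*, arXiv:1504.03215, §3 Thm 1 (the collision sums of one trajectory);
C. Cercignani, R. Illner, M. Pulvirenti, *The Mathematical Theory of Dilute Gases*, 1994, §4.2
(elastic reflection conserves the pair energy).
-/

noncomputable section

namespace Summit.AtomisticToContinuum.HydrodynamicLimit.Theorems.ChaosClosesEulerCollisionMomentUI

open scoped BigOperators Topology Classical MeasureTheory ENNReal InnerProductSpace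
open Filter Set MeasureTheory
open Literature.MathematicalPhysics.KineticTheory
open Literature.Analysis.FluidPDE
open Summit.AtomisticToContinuum.HydrodynamicLimit.Theses

/-! ## §1 The scalar Chebyshev step -/

/-- **Chebyshev inside one contact term.** If `|v'|² + |w'|² = |v|² + |w|²` (pre- vs
post-collisional pair) and `L ≥ 0`, then
`(1 + |v|² + |w|²)·1{L < |v|² + |w|²} ≤ 3/(1 + L) · (1 + |v'|⁴ + |w'|⁴)(1 + 1/(π|v' − w'|))`:
`1 + S ≤ (1 + S)²/(1 + L)` on `{L < S}`, `(1 + S)² ≤ 3(1 + S²/2) ≤ 3(1 + |v'|⁴ + |w'|⁴)` and the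
de-fluxing factor is `≥ 1`. [folklore] -/
theorem tail_term_le {v w v' w' : V3} {L : ℝ} (hL : 0 ≤ L)
    (he : ‖v'‖ ^ 2 + ‖w'‖ ^ 2 = ‖v‖ ^ 2 + ‖w‖ ^ 2) :
    (if L < ‖v‖ ^ 2 + ‖w‖ ^ 2 then 1 + ‖v‖ ^ 2 + ‖w‖ ^ 2 else 0) ≤
      3 / (1 + L) * ((1 + ‖v'‖ ^ 4 + ‖w'‖ ^ 4) * (1 + 1 / (Real.pi * ‖v' - w'‖))) := by
  have hq : 0 ≤ 1 / (Real.pi * ‖v' - w'‖) := by positivity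
  have hL1 : 0 < 1 + L := by linarith
  have h0 : 0 ≤ 1 + ‖v'‖ ^ 4 + ‖w'‖ ^ 4 := by positivity
  have hkey : (1 + (‖v‖ ^ 2 + ‖w‖ ^ 2)) ^ 2 ≤ 3 * (1 + ‖v'‖ ^ 4 + ‖w'‖ ^ 4) := by
    have h4v : ‖v'‖ ^ 4 = (‖v'‖ ^ 2) ^ 2 := by ring
    have h4w : ‖w'‖ ^ 4 = (‖w'‖ ^ 2) ^ 2 := by ring
    rw [← he, h4v, h4w]
    nlinarith [sq_nonneg (‖v'‖ ^ 2 - ‖w'‖ ^ 2), sq_nonneg (‖v'‖ ^ 2 + ‖w'‖ ^ 2 - 2)]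
  split_ifs with hlt
  · rw [div_mul_eq_mul_div, le_div_iff₀ hL1]
    have hS : 0 ≤ 1 + ‖v‖ ^ 2 + ‖w‖ ^ 2 := by positivity
    calc (1 + ‖v‖ ^ 2 + ‖w‖ ^ 2) * (1 + L)
        ≤ (1 + ‖v‖ ^ 2 + ‖w‖ ^ 2) * (1 + (‖v‖ ^ 2 + ‖w‖ ^ 2)) :=
          mul_le_mul_of_nonneg_left (by linarith) hS
      _ = (1 + (‖v‖ ^ 2 + ‖w‖ ^ 2)) ^ 2 := by ring
      _ ≤ 3 * (1 + ‖v'‖ ^ 4 + ‖w'‖ ^ 4) := hkey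
      _ ≤ 3 * ((1 + ‖v'‖ ^ 4 + ‖w'‖ ^ 4) * (1 + 1 / (Real.pi * ‖v' - w'‖))) := by
          nlinarith [mul_nonneg h0 hq]
  · positivity

/-- The threshold algebra: with `L = 3 max(Kb, 0)/η`, `η < T ≤ 3/(1 + L) · X` forces `Kb < X`
(`η(1 + L)/3 = η/3 + max(Kb, 0)`). [folklore] -/
theorem lt_of_tail_bound {η T X Kb : ℝ} (hη : 0 < η) (h1 : η < T)
    (h2 : T ≤ 3 / (1 + 3 * max Kb 0 / η) * X) : Kb < X := by
  have hK : 0 ≤ max Kb 0 := le_max_right _ _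
  have hL : 0 < 1 + 3 * max Kb 0 / η := by positivity
  have h3 : η < 3 / (1 + 3 * max Kb 0 / η) * X := h1.trans_le h2
  rw [div_mul_eq_mul_div, lt_div_iff₀ hL] at h3
  have h4 : η * (1 + 3 * max Kb 0 / η) = η + 3 * max Kb 0 := by
    field_simp
  rw [h4] at h3
  have h5 := le_max_left Kb 0
  linarith

/-! ## §2 The pathwise bound along a good orbit -/

/-- **The fast-pair part of `K_N[1 + |vᵢ|² + |vⱼ|²]` is dominated by the quartic tightness
functional, pathwise.** Along a good orbit of the hard-sphere flow on `𝕋³` (`ε = hsDiameter σ N`),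
for `L ≥ 0`,
`(ε/(N+1)) Σ_{collisions s ∈ [0, τ]} Σ_{ordered contact pairs} (1 + |vᵢ|² + |vⱼ|²)1{L < |vᵢ|² + |vⱼ|²}`
`≤ 3/(1 + L) · (ε/(N+1)) ∫ (1 + |v⁻|⁴ + |v*⁻|⁴)(1 + 1/(π|v⁻ − v*⁻|)) dκ_N([0, τ])`:
unfold the integral to the same collision sum
(`HardSphereFlow.integral_empiricalCollisionMeasure_eq_finsum_ite`) and compare termwise with
`tail_term_le`, the recorded pre-collisional pair having the same energy
(`norm_sq_reflectVel_fst_add_norm_sq_reflectVel_snd`). [folklore] -/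
theorem tail_functional_le {σ : ℝ} (hσ : 0 < σ) {N : ℕ}
    (Φ : HardSphereFlow (Torus.geometry (Fin 3)) (hsDiameter σ N) (N + 1))
    {z : Config (N + 1) (Fin 3) T3} (hz : z ∈ Φ.good) (τ : ℝ) {L : ℝ} (hL : 0 ≤ L) :
    hsDiameter σ N / (N + 1 : ℝ) *
        ∑ᶠ (s : ℝ) (_ : s ∈ collisionTimes (Torus.geometry (Fin 3)) (hsDiameter σ N)
          (fun t => Φ.flow t z) ∩ Set.Icc 0 τ),
          ∑ i : Fin (N + 1), ∑ j : Fin (N + 1),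
            (if i ≠ j ∧ ‖(Torus.geometry (Fin 3)).sepVec (Φ.flow s z i).1 (Φ.flow s z j).1‖ =
                hsDiameter σ N then
              (if L < ‖(Φ.flow s z i).2‖ ^ 2 + ‖(Φ.flow s z j).2‖ ^ 2 then
                1 + ‖(Φ.flow s z i).2‖ ^ 2 + ‖(Φ.flow s z j).2‖ ^ 2 else 0)
            else 0) ≤
      3 / (1 + L) * (hsDiameter σ N / (N + 1 : ℝ) *
        ∫ m, (1 + ‖m.2.2.2.1‖ ^ 4 + ‖m.2.2.2.2‖ ^ 4) * (1 + 1 / (Real.pi * ‖m.2.2.2.1 - m.2.2.2.2‖))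
          ∂(Φ.empiricalCollisionMeasure (Set.Icc 0 τ) z)) := by
  have hεN : 0 ≤ hsDiameter σ N / (N + 1 : ℝ) :=
    div_nonneg (hsDiameter_pos hσ N).le (by positivity)
  have hfin := Φ.finite_collisionTimes_inter hz (Subset.refl (Set.Icc 0 τ))
  rw [Φ.integral_empiricalCollisionMeasure_eq_finsum_ite hz (Subset.refl (Set.Icc 0 τ)),
    finsum_mem_eq_finite_toFinset_sum _ hfin, finsum_mem_eq_finite_toFinset_sum _ hfin, mul_left_comm]
  refine mul_le_mul_of_nonneg_left ?_ hεN
  rw [Finset.mul_sum]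
  refine Finset.sum_le_sum fun s _ => ?_
  rw [Finset.mul_sum]
  refine Finset.sum_le_sum fun i _ => ?_
  rw [Finset.mul_sum]
  refine Finset.sum_le_sum fun j _ => ?_
  by_cases hij : i ≠ j ∧
      ‖(Torus.geometry (Fin 3)).sepVec (Φ.flow s z i).1 (Φ.flow s z j).1‖ = hsDiameter σ N
  · rw [if_pos hij, if_pos hij]
    exact tail_term_le hL (norm_sq_reflectVel_fst_add_norm_sq_reflectVel_snd _
      ((Φ.flow s z i).2, (Φ.flow s z j).2))
  · simp only [if_neg hij, mul_zero, le_refl]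

/-! ## §3 The event bound and the registered stub -/

/-- **The event bound at one particle number.** If the tightness event
`{Kb < (ε/(N+1)) ∫ (1 + |v⁻|⁴ + |v*⁻|⁴)(1 + 1/(π|v⁻ − v*⁻|)) dκ_N}` has local-Gibbs probability
`≤ b`, then so does the tail event `{η < K_N[(1 + |vᵢ|² + |vⱼ|²)1{3 max(Kb,0)/η < |vᵢ|² + |vⱼ|²}]}`:
off the bad set, which is null for the local Gibbs law (`≪` Liouville, `measure_compl_good`), the
latter is contained in the former (`tail_functional_le`, `lt_of_tail_bound`). [folklore] -/
theorem measure_tail_event_le {σ : ℝ} (hσ : 0 < σ) {a₀ θ₀ : T3 → ℝ} {u₀ : T3 → V3} {N : ℕ}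
    (Φ : HardSphereFlow (Torus.geometry (Fin 3)) (hsDiameter σ N) (N + 1)) (τ : ℝ) {η : ℝ}
    (hη : 0 < η) (Kb : ℝ) {b : ℝ≥0∞}
    (hKb : localGibbsLaw σ a₀ u₀ θ₀ N Φ {z | Kb < hsDiameter σ N / (N + 1 : ℝ) *
      ∫ m, (1 + ‖m.2.2.2.1‖ ^ 4 + ‖m.2.2.2.2‖ ^ 4) * (1 + 1 / (Real.pi * ‖m.2.2.2.1 - m.2.2.2.2‖))
        ∂(Φ.empiricalCollisionMeasure (Set.Icc 0 τ) z)} ≤ b) :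
    localGibbsLaw σ a₀ u₀ θ₀ N Φ {z | η < hsDiameter σ N / (N + 1 : ℝ) *
        ∑ᶠ (s : ℝ) (_ : s ∈ collisionTimes (Torus.geometry (Fin 3)) (hsDiameter σ N)
          (fun t => Φ.flow t z) ∩ Set.Icc 0 τ),
          ∑ i : Fin (N + 1), ∑ j : Fin (N + 1),
            (if i ≠ j ∧ ‖(Torus.geometry (Fin 3)).sepVec (Φ.flow s z i).1 (Φ.flow s z j).1‖ =
                hsDiameter σ N then
              (if 3 * max Kb 0 / η < ‖(Φ.flow s z i).2‖ ^ 2 + ‖(Φ.flow s z j).2‖ ^ 2 then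
                1 + ‖(Φ.flow s z i).2‖ ^ 2 + ‖(Φ.flow s z j).2‖ ^ 2 else 0)
            else 0)} ≤ b := by
  have hL : (0 : ℝ) ≤ 3 * max Kb 0 / η := by positivity
  -- the bad set is null for the local Gibbs law (`≪` Liouville)
  have hnull : localGibbsLaw σ a₀ u₀ θ₀ N Φ Φ.goodᶜ = 0 := by
    unfold localGibbsLaw particleLaw
    exact withDensity_absolutelyContinuous _ _ Φ.measure_compl_good
  rw [← measure_inter_conull hnull]
  refine le_trans (measure_mono fun z hz => ?_) hKb
  exact lt_of_tail_bound hη hz.1 (tail_functional_le hσ Φ hz.2 τ hL)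

/-- **STUB `stub_collisionMomentUI` (line `Sketch`, crux `ChaosClosesEuler`, stmt-15141): uniform
integrability of the quadratic collision mark from quartic tightness.** GIVEN
`LimitCollisionMeasure.CollisionTightness` (stmt-13354), for local Gibbs data with continuous
positive profiles there is `σ₀ > 0` (the one of the tightness statement) such that for
`0 < σ < σ₀`, every family of flows, every `τ > 0` and `η, δ > 0` there are `L` and `N₀` with
`P(η < K_N[(1 + |vᵢ|² + |vⱼ|²)1{L < |vᵢ|² + |vⱼ|²}]) ≤ δ` for `N ≥ N₀`: take `Kb, N₀` from
tightness at `δ` and `L = 3 max(Kb, 0)/η` (`measure_tail_event_le`). [folklore] -/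
theorem stub_collisionMomentUI :
    LimitCollisionMeasure.CollisionTightness →
    ∀ (a₀ θ₀ : T3 → ℝ) (u₀ : T3 → V3), Continuous a₀ → Continuous θ₀ → Continuous u₀ →
    (∀ x, 0 < a₀ x) → (∀ x, 0 < θ₀ x) → ∃ σ₀ : ℝ, 0 < σ₀ ∧ ∀ σ : ℝ, 0 < σ → σ < σ₀ →
    ∀ Φ : (N : ℕ) → HardSphereFlow (Torus.geometry (Fin 3)) (hsDiameter σ N) (N + 1),
    ∀ τ : ℝ, 0 < τ → ∀ η δ : ℝ, 0 < η → 0 < δ → ∃ L : ℝ, ∃ N₀ : ℕ, ∀ N : ℕ, N₀ ≤ N →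
    let ε := hsDiameter σ N
    let G : Geometry (Fin 3) T3 := Torus.geometry (Fin 3)
    let γ : Config (N + 1) (Fin 3) T3 → ℝ → Config (N + 1) (Fin 3) T3 := fun z s => (Φ N).flow s z
    let Kc : (Config (N + 1) (Fin 3) T3 → ℝ → Fin (N + 1) → Fin (N + 1) → ℝ) →
        Config (N + 1) (Fin 3) T3 → ℝ := fun F z =>
      ε / (N + 1 : ℝ) * ∑ᶠ (s : ℝ) (_ : s ∈ collisionTimes G ε (γ z) ∩ Set.Icc 0 τ),
        ∑ i : Fin (N + 1), ∑ j : Fin (N + 1),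
          (if i ≠ j ∧ ‖G.sepVec (γ z s i).1 (γ z s j).1‖ = ε then F z s i j else 0)
    localGibbsLaw σ a₀ u₀ θ₀ N (Φ N)
        {z | η < Kc (fun z s i j => if L < ‖(γ z s i).2‖ ^ 2 + ‖(γ z s j).2‖ ^ 2 then
          1 + ‖(γ z s i).2‖ ^ 2 + ‖(γ z s j).2‖ ^ 2 else 0) z} ≤ ENNReal.ofReal δ := by
  intro hCT a₀ θ₀ u₀ ha hθ hu ha0 hθ0
  obtain ⟨σ₀, hσ₀, H⟩ := hCT a₀ θ₀ u₀ ha hθ hu ha0 hθ0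
  refine ⟨σ₀, hσ₀, fun σ hσ hσlt Φ τ hτ η δ hη hδ => ?_⟩
  obtain ⟨Kb, N₀, hKb⟩ := H σ hσ hσlt Φ τ hτ δ hδ
  refine ⟨3 * max Kb 0 / η, N₀, fun N hN => ?_⟩
  exact measure_tail_event_le hσ (Φ N) τ hη Kb (hKb N hN)

end Summit.AtomisticToContinuum.HydrodynamicLimit.Theorems.ChaosClosesEulerCollisionMomentUI

end
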